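import Literature.Analysis.FunctionSpaces.TorusAnalyticCompositionProof
import HarnessLib

/-!
# The Faà di Bruno remainder of a composition with a near-identity map: Armstrong–Vicol's
# "chain rule on steroids" split and the bound on `E_old` (App. A Prop. 7.11, (7.3.5)–(7.3.6))

Analysis/FunctionSpaces proof file (theorems only; no definitions, no named facts). For a smooth
`ψ : T^d → ℝ`, a smooth displacement `D : T^d → ℝ^d`, `G = id + D∘proj` (the lift of `X = id + proj∘D`)
and a word `J` of length `n ≥ 2`, Faà di Bruno gives
`Dⁿ(ψ∘proj∘G)(v)(e_J) = D(ψ∘proj)(G v)[DⁿG(v)(e_J)] + E_old`, where `E_old` collects the ordered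
finpartitions with at least two blocks — so it only sees derivatives of `G` of order `≤ n − 1`
(`iteratedFDeriv_comp_sub_eq_sum`). If `⟦ψ⟧_{k,R_f} ≤ C_f` (`1 ≤ k ≤ n`) and the lower derivatives of `G`
obey `‖DˢG(v)(e_K)‖ ≤ p_s ρˢ/((s+1)² d R_f)` (`1 ≤ s ≤ n−1`) with shifted-factorial weights `p_1 = b`,
`p_{s+1} = (s−b)p_s`, `p ≥ 0` (Armstrong–Vicol: `p_s = (−1)^{s−1} binom(½,s) s!`, `b = ½`,
`ρ = 8dR_f(1+Bt)`), then
`|E_old| ≤ C_f ρⁿ (n+1)⁻² Π_{j<n} (j + b)` (`norm_faaDiBrunoRemainder_le`; componentwise hypotheses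
`|(DˢG(v)(e_K))_j| ≤ …` suffice: `norm_faaDiBrunoRemainder_le_of_coord`) — the printed (eq:E:old:bound)
(`= 2C_f ρⁿ(n+1)⁻²(n+1)!|binom(½,n+1)|` for `b = ½`), by the coordinate bound, Remark 7.5 and Lemma 7.3 in
total-order form (`OrderedFinpartition.sum_factorial_length_mul_prod_eq_prod_range`). The torus reading of
the linear term, `D(ψ∘proj)(G v)[DⁿG(v)(e_J)] = Σ_k ∂_kψ(X y) ∂^J D_k(y)`, is `fderiv_lift_apply_eq_sum`
/ `iteratedFDeriv_inner_eq_iterPartialDeriv`.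

## References

* S. Armstrong, V. Vicol, *Anomalous diffusion by fractal homogenization*, Ann. PDE 11 (2025),
  arXiv:2305.05048, App. A Prop. 7.11 (proof: (eq:chain:rule:steroids), (eq:E:old:bound)), Lemma 7.3,
  Remark 7.5. [`ArmstrongVicol2025`]
* L. Comtet, *Advanced Combinatorics* (Reidel 1974), Ch. III §3.4 (Faà di Bruno). [`Comtet1974`]
-/

noncomputable section

open Set Function Finset
open scoped Nat ContDiff

namespace Literature.Analysis.FunctionSpaces

namespace Torus

variable {d : Type*} [Fintype d] [DecidableEq d]

/-! ## §1 The split -/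

omit [DecidableEq d] in
/-- **Chain rule on steroids (the split)**: `Dⁿ(g∘G)(v)(m) − Dg(G v)[DⁿG(v)(m)]` is the sum of the Faà di
Bruno terms over the ordered finpartitions with `|c| ≠ 1`. [cite: ArmstrongVicol2025, App. A Prop. 7.11 (eq:chain:rule:steroids)] -/
theorem iteratedFDeriv_comp_sub_eq_sum {g : EuclideanSpace ℝ d → ℝ} {G : EuclideanSpace ℝ d → EuclideanSpace ℝ d}
    (hg : ContDiff ℝ ∞ g) (hG : ContDiff ℝ ∞ G) (v : EuclideanSpace ℝ d) {n : ℕ} (hn : 1 ≤ n)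
    (m : Fin n → EuclideanSpace ℝ d) :
    iteratedFDeriv ℝ n (g ∘ G) v m - _root_.fderiv ℝ g (G v) (iteratedFDeriv ℝ n G v m) =
      ∑ c ∈ (Finset.univ : Finset (OrderedFinpartition n)).filter (fun c => c.length ≠ 1),
        iteratedFDeriv ℝ c.length g (G v) (fun i => iteratedFDeriv ℝ (c.partSize i) G v (m ∘ c.emb i)) := by
  classical
  rw [iteratedFDeriv_comp_apply_eq_sum hg hG v n m, ← Finset.sum_filter_add_sum_filter_not Finset.univ (fun c => c.length ≠ 1)]
  simp only [ne_eq, Decidable.not_not, add_sub_assoc]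
  convert add_zero _
  rw [sub_eq_zero]
  -- the single-block partition
  have hmem : ∀ c ∈ (Finset.univ : Finset (OrderedFinpartition n)).filter (fun c => c.length = 1),
      iteratedFDeriv ℝ c.length g (G v) (fun i => iteratedFDeriv ℝ (c.partSize i) G v (m ∘ c.emb i)) =
        _root_.fderiv ℝ g (G v) (iteratedFDeriv ℝ n G v m) := by
    intro c hc
    rw [Finset.mem_filter] at hc
    obtain ⟨-, hc⟩ := hc
    -- partSize 0 = n and emb 0 = cast
    have h0 : 0 < c.length := by omega
    have hps : c.partSize ⟨0, h0⟩ = n := by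
      have h := Fintype.card_congr c.equivSigma
      simp only [Fintype.card_sigma, Fintype.card_fin] at h
      have : (Finset.univ : Finset (Fin c.length)) = {⟨0, h0⟩} := by
        ext i; simp [Fin.ext_iff]; omega
      rw [this, Finset.sum_singleton] at h
      exact h
    -- the embedding of the unique block is the cast
    have hemb : ∀ t : Fin (c.partSize ⟨0, h0⟩), c.emb ⟨0, h0⟩ t = Fin.cast hps t := by
      have hsm := c.emb_strictMono ⟨0, h0⟩
      -- a strictly monotone map `Fin n' → Fin n` with `n' = n` is the cast
      let e : Fin (c.partSize ⟨0, h0⟩) ↪o Fin n := OrderEmbedding.ofStrictMono (c.emb ⟨0, h0⟩) hsm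
      have h1 : e = Finset.univ.orderEmbOfFin (by rw [Finset.card_univ, Fintype.card_fin, hps]) :=
        Finset.orderEmbOfFin_unique' _ fun x => Finset.mem_univ _
      let e' : Fin (c.partSize ⟨0, h0⟩) ↪o Fin n := (Fin.castOrderIso hps).toOrderEmbedding
      have h2 : e' = Finset.univ.orderEmbOfFin (by rw [Finset.card_univ, Fintype.card_fin, hps]) :=
        Finset.orderEmbOfFin_unique' _ fun x => Finset.mem_univ _
      intro t
      have := congrArg (fun f : Fin (c.partSize ⟨0, h0⟩) ↪o Fin n => f t) (h1.trans h2.symm)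
      simpa [e, e'] using this
    -- rewrite the term through `c.length = 1`
    have key : ∀ (k : ℕ) (hk : k = 1) (s : Fin k → ℕ) (u : ∀ i : Fin k, (Fin (s i) → EuclideanSpace ℝ d))
        (hs : s ⟨0, by omega⟩ = n)
        (hu : ∀ t, u ⟨0, by omega⟩ t = m (Fin.cast hs t)),
        iteratedFDeriv ℝ k g (G v) (fun i => iteratedFDeriv ℝ (s i) G v (u i)) =
          _root_.fderiv ℝ g (G v) (iteratedFDeriv ℝ n G v m) := by
      intro k hk s u hs hu
      subst hk
      rw [iteratedFDeriv_one_apply]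
      congr 1
      -- transport along `s 0 = n`
      have hs' : s 0 = n := hs
      subst hs'
      show iteratedFDeriv ℝ (s 0) G v (u 0) = iteratedFDeriv ℝ (s 0) G v m
      congr 1
      funext t
      have h := hu t
      have hc' : Fin.cast hs t = t := Fin.ext rfl
      rw [hc'] at h
      exact h
    exact key c.length hc c.partSize (fun i => m ∘ c.emb i) hps fun t => by
      show m (c.emb ⟨0, h0⟩ t) = m (Fin.cast hps t)
      rw [hemb t]
  rw [Finset.sum_congr rfl hmem, Finset.sum_const, nsmul_eq_mul]
  -- exactly one single-block partition
  have hcard : ((Finset.univ : Finset (OrderedFinpartition n)).filter (fun c => c.length = 1)).card = 1 := by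
    obtain ⟨n', rfl⟩ : ∃ n', n = n' + 1 := ⟨n - 1, by omega⟩
    -- count via the Lah sum with `k = 0`: `1! · L(n'+1, 1) = (n'+1)! · C(n', 0)` and each single-block
    -- partition has weight `Π (partSize)! = (n'+1)!`
    have hL := OrderedFinpartition.factorial_mul_lahSum n' 0
    rw [zero_add, Nat.factorial_one, one_mul, Nat.choose_zero_right, mul_one] at hL
    have hw : ∀ c ∈ (Finset.univ : Finset (OrderedFinpartition (n' + 1))).filter (fun c => c.length = 1),
        (∏ i, (c.partSize i)!) = (n' + 1)! := by
      intro c hc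
      rw [Finset.mem_filter] at hc
      have h0 : 0 < c.length := by omega
      have huniv : (Finset.univ : Finset (Fin c.length)) = {⟨0, h0⟩} := by
        ext i; simp [Fin.ext_iff]; omega
      have hps : c.partSize ⟨0, h0⟩ = n' + 1 := by
        have h := Fintype.card_congr c.equivSigma
        simp only [Fintype.card_sigma, Fintype.card_fin] at h
        rw [huniv, Finset.sum_singleton] at h
        exact h
      rw [huniv, Finset.prod_singleton, hps]
    have hsum : (∑ c : OrderedFinpartition (n' + 1), if c.length = 1 then ∏ i, (c.partSize i)! else 0) =
        ((Finset.univ : Finset (OrderedFinpartition (n' + 1))).filter (fun c => c.length = 1)).card * (n' + 1)! := by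
      rw [← Finset.sum_filter, Finset.sum_congr rfl hw, Finset.sum_const, smul_eq_mul]
    rw [hsum] at hL
    have hpos : 0 < (n' + 1)! := Nat.factorial_pos _
    exact Nat.eq_of_mul_eq_mul_right hpos (by rw [hL, one_mul])
  rw [hcard, Nat.cast_one, one_mul]

/-! ## §2 The bound on `E_old` -/

omit [DecidableEq d] in
/-- Part sizes add up to `n`. [folklore] -/
private theorem sum_partSize₃ {n : ℕ} (c : OrderedFinpartition n) : ∑ i, c.partSize i = n := by
  have h := Fintype.card_congr c.equivSigma
  simpa [Fintype.card_sigma] using h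

omit [DecidableEq d] in
/-- In a partition with at least two parts, every part has size `≤ n − 1`. [folklore] -/
private theorem partSize_succ_le {n : ℕ} (c : OrderedFinpartition n) (hc : c.length ≠ 1) (hn : 1 ≤ n)
    (i : Fin c.length) : c.partSize i + 1 ≤ n := by
  have hk : 0 < c.length := c.length_pos (by omega)
  have h2 : 2 ≤ c.length := by omega
  -- another part `i' ≠ i`
  obtain ⟨i', hi'⟩ : ∃ i' : Fin c.length, i' ≠ i := by
    by_cases h : (i : ℕ) = 0
    · exact ⟨⟨1, h2⟩, fun e => by simp [Fin.ext_iff, h] at e⟩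
    · exact ⟨⟨0, hk⟩, fun e => h (by rw [← e])⟩
  have hsub : ({i, i'} : Finset (Fin c.length)) ⊆ Finset.univ := Finset.subset_univ _
  have h := Finset.sum_le_sum_of_subset_of_nonneg hsub (f := fun j => c.partSize j) (fun j _ _ => Nat.zero_le _)
  rw [Finset.sum_pair (Ne.symm hi'), sum_partSize₃] at h
  have := c.partSize_pos i'
  omega

omit [DecidableEq d] in
/-- **Remark 7.5** (total-order form). [cite: ArmstrongVicol2025, App. A Remark 7.5] -/
private theorem remark75' {n : ℕ} (hn : 1 ≤ n) (c : OrderedFinpartition n) :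
    ((n : ℝ) + 1) ^ 2 ≤ ((c.length : ℝ) + 1) ^ 2 * ∏ i, ((c.partSize i : ℝ) + 1) ^ 2 := by
  have hk : 0 < c.length := c.length_pos (by omega)
  obtain ⟨i0, -, hi0⟩ : ∃ i ∈ (Finset.univ : Finset (Fin c.length)), n ≤ c.length * c.partSize i := by
    refine Finset.exists_le_of_sum_le ?_ (le_of_eq ?_)
    · exact ⟨⟨0, hk⟩, Finset.mem_univ _⟩
    · rw [Finset.sum_const, Finset.card_univ, Fintype.card_fin, smul_eq_mul, ← Finset.mul_sum, sum_partSize₃]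
  have h1 : (n : ℝ) + 1 ≤ ((c.length : ℝ) + 1) * ((c.partSize i0 : ℝ) + 1) := by
    have h : (n : ℝ) ≤ (c.length : ℝ) * (c.partSize i0 : ℝ) := by exact_mod_cast hi0
    nlinarith [h, (Nat.cast_nonneg c.length : (0 : ℝ) ≤ c.length), (Nat.cast_nonneg (c.partSize i0) : (0 : ℝ) ≤ _)]
  have h2 : ((c.partSize i0 : ℝ) + 1) ^ 2 ≤ ∏ i, ((c.partSize i : ℝ) + 1) ^ 2 := by
    calc ((c.partSize i0 : ℝ) + 1) ^ 2 = ∏ i, (if i = i0 then ((c.partSize i : ℝ) + 1) ^ 2 else 1) := by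
          rw [Finset.prod_ite_eq']; simp
      _ ≤ ∏ i, ((c.partSize i : ℝ) + 1) ^ 2 := by
          refine Finset.prod_le_prod (fun i _ => ?_) (fun i _ => ?_)
          · split_ifs <;> positivity
          · split_ifs with h
            · exact le_rfl
            · nlinarith [(Nat.cast_nonneg (c.partSize i) : (0 : ℝ) ≤ _)]
  calc ((n : ℝ) + 1) ^ 2 ≤ (((c.length : ℝ) + 1) * ((c.partSize i0 : ℝ) + 1)) ^ 2 :=
        pow_le_pow_left₀ (by positivity) h1 2
    _ = ((c.length : ℝ) + 1) ^ 2 * ((c.partSize i0 : ℝ) + 1) ^ 2 := by ring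
    _ ≤ ((c.length : ℝ) + 1) ^ 2 * ∏ i, ((c.partSize i : ℝ) + 1) ^ 2 :=
        mul_le_mul_of_nonneg_left h2 (by positivity)

/-- **The bound on `E_old`, componentwise hypotheses** ((eq:E:old:bound) of the proof of Prop. 7.11, in
the sup-over-components bookkeeping of the printed induction): let `ψ : T^d → ℝ` be smooth with
`⟦ψ⟧_{k,R_f} ≤ C_f` for `1 ≤ k ≤ n`, `G : ℝ^d → ℝ^d` smooth with EVERY COMPONENT
`|(DˢG(v)(e_{K₁},…,e_{K_s}))_j| ≤ p_s ρˢ/((s+1)² d R_f)` for `1 ≤ s ≤ n − 1` and all words `K`, where the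
weights satisfy `p ≥ 0`, `p 1 = b ≥ 0`, `p(s+1) = (s − b) p s` (`s ≥ 1`). Then for every word `J` of length
`n ≥ 2`, `‖Dⁿ(ψ∘proj∘G)(v)(e_J) − D(ψ∘proj)(G v)[DⁿG(v)(e_J)]‖ ≤ C_f ρⁿ (n+1)⁻² Π_{j<n}(j + b)`.
(Armstrong–Vicol: `p_s = (−1)^{s−1}binom(½,s)s!`, `b = ½`, `ρ = 8dR_f(1+Bt)`, right side
`= 2C_f ρⁿ(n+1)⁻²(n+1)!|binom(½,n+1)|`.) [cite: ArmstrongVicol2025, App. A Prop. 7.11 (eq:E:old:bound)] -/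
theorem norm_faaDiBrunoRemainder_le_of_coord {n : ℕ} (hn : 2 ≤ n) {ψ : UnitAddTorus d → ℝ} (hψ : IsSmooth ψ)
    {G : EuclideanSpace ℝ d → EuclideanSpace ℝ d} (hG : ContDiff ℝ ∞ G)
    {Cf Rf ρ b : ℝ} (hCf : 0 ≤ Cf) (hRf : 0 < Rf) (hρ : 0 ≤ ρ) (p : ℕ → ℝ) (hp0 : ∀ s, 0 ≤ p s)
    (h1 : p 1 = b) (hrec : ∀ s : ℕ, 1 ≤ s → p (s + 1) = ((s : ℝ) - b) * p s)
    (hf : ∀ k, 1 ≤ k → k ≤ n → dnorm k Rf ψ ≤ Cf)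
    (hX : ∀ s, 1 ≤ s → s + 1 ≤ n → ∀ (K : Fin s → d) (v : EuclideanSpace ℝ d) (j : d),
      |(iteratedFDeriv ℝ s G v (fun i => EuclideanSpace.single (K i) (1 : ℝ))) j| ≤
        p s * ρ ^ s / (((s : ℝ) + 1) ^ 2 * ((Fintype.card d : ℝ) * Rf)))
    (J : Fin n → d) (v : EuclideanSpace ℝ d) :
    ‖iteratedFDeriv ℝ n (lift ψ ∘ G) v (fun t => EuclideanSpace.single (J t) (1 : ℝ)) -
        _root_.fderiv ℝ (lift ψ) (G v) (iteratedFDeriv ℝ n G v (fun t => EuclideanSpace.single (J t) (1 : ℝ)))‖ ≤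
      Cf * ρ ^ n / ((n : ℝ) + 1) ^ 2 * ∏ j ∈ Finset.range n, ((j : ℝ) + b) := by
  classical
  obtain ⟨n', rfl⟩ : ∃ n', n = n' + 1 := ⟨n - 1, by omega⟩
  have hd : 0 < (Fintype.card d : ℝ) := by
    have : Nonempty d := ⟨J ⟨0, by omega⟩⟩
    exact_mod_cast Fintype.card_pos
  rw [iteratedFDeriv_comp_sub_eq_sum (show ContDiff ℝ ∞ (lift ψ) from hψ) hG v (by omega)]
  -- termwise bound
  have hM : ∀ (c : OrderedFinpartition (n' + 1)) (J' : Fin c.length → d),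
      ‖iteratedFDeriv ℝ c.length (lift ψ) (G v) (fun i => EuclideanSpace.single (J' i) (1 : ℝ))‖ ≤
        Cf * (((c.length)! : ℝ) * Rf ^ c.length) / ((c.length : ℝ) + 1) ^ 2 := by
    intro c J'
    rw [iteratedFDeriv_lift_apply_single hψ c.length J' _]
    exact norm_iterPartialDeriv_le_of_dnorm_le hψ hRf (hf c.length (c.length_pos (by omega)) c.length_le)
      (List.length_ofFn) _
  have hterm : ∀ c ∈ (Finset.univ : Finset (OrderedFinpartition (n' + 1))).filter (fun c => c.length ≠ 1),
      ‖iteratedFDeriv ℝ c.length (lift ψ) (G v)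
          (fun i => iteratedFDeriv ℝ (c.partSize i) G v ((fun t => EuclideanSpace.single (J t) (1 : ℝ)) ∘ c.emb i))‖ ≤
        Cf * ρ ^ (n' + 1) / ((n' : ℝ) + 1 + 1) ^ 2 * (((c.length)! : ℝ) * ∏ i, p (c.partSize i)) := by
    intro c hc
    rw [Finset.mem_filter] at hc
    have hc1 : c.length ≠ 1 := hc.2
    refine (norm_apply_le_of_basis_bound _ (hM c) _).trans ?_
    -- block bounds
    have hblock : ∀ i : Fin c.length,
        ∑ j, |(iteratedFDeriv ℝ (c.partSize i) G v ((fun t => EuclideanSpace.single (J t) (1 : ℝ)) ∘ c.emb i)) j| ≤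
          (Fintype.card d : ℝ) * (p (c.partSize i) * ρ ^ c.partSize i /
            (((c.partSize i : ℝ) + 1) ^ 2 * ((Fintype.card d : ℝ) * Rf))) := by
      intro i
      have hu := hX (c.partSize i) (c.partSize_pos i) (partSize_succ_le c hc1 (by omega) i)
        (fun t => J (c.emb i t)) v
      calc ∑ j, |(iteratedFDeriv ℝ (c.partSize i) G v ((fun t => EuclideanSpace.single (J t) (1 : ℝ)) ∘ c.emb i)) j|
          ≤ ∑ _j : d, p (c.partSize i) * ρ ^ c.partSize i /
              (((c.partSize i : ℝ) + 1) ^ 2 * ((Fintype.card d : ℝ) * Rf)) :=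
            Finset.sum_le_sum fun j _ => hu j
        _ = _ := by rw [Finset.sum_const, Finset.card_univ, nsmul_eq_mul]
    have hprod := Finset.prod_le_prod (s := (Finset.univ : Finset (Fin c.length)))
      (fun i _ => Finset.sum_nonneg fun j _ => abs_nonneg _) fun i _ => hblock i
    refine (mul_le_mul_of_nonneg_left hprod (by positivity)).trans ?_
    -- algebra + Remark 7.5
    have hP : 0 < ∏ i, ((c.partSize i : ℝ) + 1) ^ 2 := Finset.prod_pos fun i _ => by positivity
    have e1 : ∏ i, ((Fintype.card d : ℝ) * (p (c.partSize i) * ρ ^ c.partSize i /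
        (((c.partSize i : ℝ) + 1) ^ 2 * ((Fintype.card d : ℝ) * Rf)))) =
        (ρ ^ (n' + 1) * ∏ i, p (c.partSize i)) / (Rf ^ c.length * ∏ i, ((c.partSize i : ℝ) + 1) ^ 2) := by
      have e0 : ∀ i : Fin c.length, (Fintype.card d : ℝ) * (p (c.partSize i) * ρ ^ c.partSize i /
          (((c.partSize i : ℝ) + 1) ^ 2 * ((Fintype.card d : ℝ) * Rf))) =
          (p (c.partSize i) * ρ ^ c.partSize i) / (((c.partSize i : ℝ) + 1) ^ 2 * Rf) := by
        intro i
        field_simp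
      simp_rw [e0]
      rw [Finset.prod_div_distrib, Finset.prod_mul_distrib, Finset.prod_mul_distrib, Finset.prod_pow_eq_pow_sum,
        sum_partSize₃, Finset.prod_const, Finset.card_univ, Fintype.card_fin]
      ring
    rw [e1]
    have h75 := remark75' (by omega : 1 ≤ n' + 1) c
    have e2 : Cf * (((c.length)! : ℝ) * Rf ^ c.length) / ((c.length : ℝ) + 1) ^ 2 *
        ((ρ ^ (n' + 1) * ∏ i, p (c.partSize i)) / (Rf ^ c.length * ∏ i, ((c.partSize i : ℝ) + 1) ^ 2)) =
        Cf * ρ ^ (n' + 1) * (((c.length)! : ℝ) * ∏ i, p (c.partSize i)) *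
          (1 / (((c.length : ℝ) + 1) ^ 2 * ∏ i, ((c.partSize i : ℝ) + 1) ^ 2)) := by
      field_simp
    have e3 : Cf * ρ ^ (n' + 1) / ((n' : ℝ) + 1 + 1) ^ 2 * (((c.length)! : ℝ) * ∏ i, p (c.partSize i)) =
        Cf * ρ ^ (n' + 1) * (((c.length)! : ℝ) * ∏ i, p (c.partSize i)) * (1 / ((n' : ℝ) + 1 + 1) ^ 2) := by
      field_simp
    rw [e2, e3]
    have hw : 0 ≤ Cf * ρ ^ (n' + 1) * (((c.length)! : ℝ) * ∏ i, p (c.partSize i)) := by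
      have : 0 ≤ ∏ i, p (c.partSize i) := Finset.prod_nonneg fun i _ => hp0 _
      positivity
    refine mul_le_mul_of_nonneg_left ?_ hw
    rw [one_div_le_one_div (by positivity) (by positivity)]
    have : ((n' : ℝ) + 1 + 1) = (((n' + 1 : ℕ) : ℝ) + 1) := by push_cast; ring
    rw [this]
    exact h75
  -- sum: nonnegative weights, extend to all partitions, evaluate
  refine (norm_sum_le _ _).trans ((Finset.sum_le_sum hterm).trans ?_)
  have hnn : ∀ c ∈ (Finset.univ : Finset (OrderedFinpartition (n' + 1))),
      c ∉ (Finset.univ : Finset (OrderedFinpartition (n' + 1))).filter (fun c => c.length ≠ 1) →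
      0 ≤ Cf * ρ ^ (n' + 1) / ((n' : ℝ) + 1 + 1) ^ 2 * (((c.length)! : ℝ) * ∏ i, p (c.partSize i)) := by
    intro c _ _
    have : 0 ≤ ∏ i, p (c.partSize i) := Finset.prod_nonneg fun i _ => hp0 _
    positivity
  refine (Finset.sum_le_sum_of_subset_of_nonneg (Finset.filter_subset _ _) hnn).trans (le_of_eq ?_)
  rw [← Finset.mul_sum, OrderedFinpartition.sum_factorial_length_mul_prod_eq_prod_range p b h1 hrec n']
  push_cast
  ring

/-- **The bound on `E_old`** ((eq:E:old:bound) of the proof of Prop. 7.11) with Euclidean-norm hypotheses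
on the lower derivatives of `G`: `‖DˢG(v)(e_{K})‖ ≤ p_s ρˢ/((s+1)² d R_f)` (`1 ≤ s ≤ n − 1`) — a corollary of
the componentwise form. [cite: ArmstrongVicol2025, App. A Prop. 7.11 (eq:E:old:bound)] -/
theorem norm_faaDiBrunoRemainder_le {n : ℕ} (hn : 2 ≤ n) {ψ : UnitAddTorus d → ℝ} (hψ : IsSmooth ψ)
    {G : EuclideanSpace ℝ d → EuclideanSpace ℝ d} (hG : ContDiff ℝ ∞ G)
    {Cf Rf ρ b : ℝ} (hCf : 0 ≤ Cf) (hRf : 0 < Rf) (hρ : 0 ≤ ρ) (p : ℕ → ℝ) (hp0 : ∀ s, 0 ≤ p s)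
    (h1 : p 1 = b) (hrec : ∀ s : ℕ, 1 ≤ s → p (s + 1) = ((s : ℝ) - b) * p s)
    (hf : ∀ k, 1 ≤ k → k ≤ n → dnorm k Rf ψ ≤ Cf)
    (hX : ∀ s, 1 ≤ s → s + 1 ≤ n → ∀ (K : Fin s → d) (v : EuclideanSpace ℝ d),
      ‖iteratedFDeriv ℝ s G v (fun i => EuclideanSpace.single (K i) (1 : ℝ))‖ ≤
        p s * ρ ^ s / (((s : ℝ) + 1) ^ 2 * ((Fintype.card d : ℝ) * Rf)))
    (J : Fin n → d) (v : EuclideanSpace ℝ d) :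
    ‖iteratedFDeriv ℝ n (lift ψ ∘ G) v (fun t => EuclideanSpace.single (J t) (1 : ℝ)) -
        _root_.fderiv ℝ (lift ψ) (G v) (iteratedFDeriv ℝ n G v (fun t => EuclideanSpace.single (J t) (1 : ℝ)))‖ ≤
      Cf * ρ ^ n / ((n : ℝ) + 1) ^ 2 * ∏ j ∈ Finset.range n, ((j : ℝ) + b) :=
  norm_faaDiBrunoRemainder_le_of_coord hn hψ hG hCf hRf hρ p hp0 h1 hrec hf
    (fun s hs hsn K v j => by
      rw [← Real.norm_eq_abs]
      exact (PiLp.norm_apply_le _ j).trans (hX s hs hsn K v)) J v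

/-! ## §3 Torus reading of the linear term -/

/-- `D(ψ∘proj)(w)[u] = Σ_k u_k ∂_kψ(proj w)`. [cite: ArmstrongVicol2025, App. A Prop. 7.11 (eq:chain:rule:steroids), the term |α| = 1] -/
theorem fderiv_lift_apply_eq_sum {F : Type*} [NormedAddCommGroup F] [NormedSpace ℝ F] {ψ : UnitAddTorus d → F}
    (hψ : IsContDiff 1 ψ) (w u : EuclideanSpace ℝ d) :
    _root_.fderiv ℝ (lift ψ) w u = ∑ k, u k • partialDeriv k ψ (proj w) := by
  classical
  have hu : u = ∑ k, u k • EuclideanSpace.single k (1 : ℝ) := by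
    conv_lhs => rw [← (EuclideanSpace.basisFun d ℝ).sum_repr u]
    simp [EuclideanSpace.basisFun_apply]
  conv_lhs => rw [hu]
  rw [map_sum]
  refine Finset.sum_congr rfl fun k _ => ?_
  rw [map_smul, partialDeriv_eq_fderiv_apply hψ, ← fderiv_lift]

omit [DecidableEq d] in
/-- Linear maps have no derivatives of order `≥ 2`. [folklore] -/
private theorem iteratedFDeriv_id_eq_zero' (j : ℕ) (w : EuclideanSpace ℝ d) :
    iteratedFDeriv ℝ (j + 2) (id : EuclideanSpace ℝ d → EuclideanSpace ℝ d) w = 0 := by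
  rw [iteratedFDeriv_succ_eq_comp_right, comp_apply]
  have e : (fun y : EuclideanSpace ℝ d => _root_.fderiv ℝ (id : EuclideanSpace ℝ d → EuclideanSpace ℝ d) y) =
      fun _ => ContinuousLinearMap.id ℝ (EuclideanSpace ℝ d) := by
    funext y; exact fderiv_id
  rw [e, iteratedFDeriv_const_of_ne (by omega), Pi.zero_apply, map_zero]

/-- **Higher derivatives of `id + D∘proj` on basis vectors are word derivatives of `D`** (`n ≥ 2`):
`Dⁿ(id + D∘proj)(v)(e_J) = ∂^J D(proj v)`. [cite: ArmstrongVicol2025, App. A Prop. 7.11 (∂^β X = ∂^β (X − id) for |β| ≥ 2)] -/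
theorem iteratedFDeriv_inner_eq_iterPartialDeriv {D : UnitAddTorus d → EuclideanSpace ℝ d} (hD : IsSmooth D)
    {n : ℕ} (hn : 2 ≤ n) (J : Fin n → d) (v : EuclideanSpace ℝ d) :
    iteratedFDeriv ℝ n (fun v => v + lift D v) v (fun t => EuclideanSpace.single (J t) (1 : ℝ)) =
      iterPartialDeriv (List.ofFn J) D (proj v) := by
  obtain ⟨j, rfl⟩ : ∃ j, n = j + 2 := ⟨n - 2, by omega⟩
  have e : (fun v : EuclideanSpace ℝ d => v + lift D v) = id + lift D := rfl
  rw [e, iteratedFDeriv_add_apply (contDiff_id.contDiffAt)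
    (((show ContDiff ℝ ∞ (lift D) from hD).of_le (WithTop.coe_le_coe.mpr le_top)).contDiffAt),
    iteratedFDeriv_id_eq_zero', zero_add, iteratedFDeriv_lift_apply_single hD]

/-- **First derivative of `id + D∘proj` on a basis vector**: `D(id + D∘proj)(v) e_j = e_j + ∂ⱼD(proj v)`.
[cite: ArmstrongVicol2025, App. A Prop. 7.10 (∇X = Id + ∇(X − id))] -/
theorem iteratedFDeriv_one_inner_eq {D : UnitAddTorus d → EuclideanSpace ℝ d} (hD : IsSmooth D)
    (K : Fin 1 → d) (v : EuclideanSpace ℝ d) :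
    iteratedFDeriv ℝ 1 (fun v => v + lift D v) v (fun i => EuclideanSpace.single (K i) (1 : ℝ)) =
      EuclideanSpace.single (K 0) (1 : ℝ) + partialDeriv (K 0) D (proj v) := by
  rw [iteratedFDeriv_one_apply]
  have hd : DifferentiableAt ℝ (lift D) v :=
    ((show ContDiff ℝ ∞ (lift D) from hD).differentiable (by simp)).differentiableAt
  have e : (fun v : EuclideanSpace ℝ d => v + lift D v) = id + lift D := rfl
  rw [e, _root_.fderiv_add differentiableAt_id hd, fderiv_id, partialDeriv_eq_fderiv_apply (hD.isContDiff (by simp)),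
    ← fderiv_lift]
  rfl

end Torus

end Literature.Analysis.FunctionSpaces

end
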